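import Mathlib
import Summits.Ventures.FusionMHD.Models.RwmFRS1Energy
import HarnessLib

/-!
# F3.r4 instance «RwmFRS1» (row «F3.r4-FRS1-RWM31»), rider: THE CRITICAL WALL RADIUS of the external `(3,1)` mode of
# MODEL M_RWM lies in `(1.05a, 1.10a)` and separates the ideal-wall-stable walls from the unstable ones — by NAME
# from lit-3's `ScrewPinchWallFactor` §12 (`criticalWallRadius`, `externalEnergy_wall_pos_iff/_neg_iff/_eq_zero_iff`)

Rider of `RwmFRS1Energy.lean` (model-6 g6; lit-3 INBOX 10:53:34Z «the critical wall position is now a typed object»).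
With `b* := P.criticalWallRadius 3 kk 1 ξ₁` (lit-3: `criticalWallArg` of the critical wall factor of the marginal
solution `ξ₁ = xi`, divided by `|k|`):
* `criticalWallRadius_spec'` — `a = 1 < b*` and `δW_{b*} = 0` (the wall factor at `b*` is the critical one);
* **`dWb_pos_iff`**, **`dWb_neg_iff`**, `dWb_eq_zero_iff` — for every wall `b > a`: `δW_b > 0 ⇔ b < b*`, `δW_b < 0 ⇔ b* < b`,
  `δW_b = 0 ⇔ b = b*` (uniqueness);
* **`criticalWallRadius_bounds`** — `21/20 < b* < 11/10`, i.e. `1.05a < b_crit < 1.10a` (from `dWb_pos` at `21/20` and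
  `dWb_neg` at `11/10`; VALIDATED float `b_crit = 1.0714a`);
* **`idealWall_stable_iff`** — for every wall `b > a`: ALL admissible displacements have positive ideal-wall energy iff
  `b < b*` (lit-4's external-mode test `externalModes_iff`); **`rwm_grows_iff`**: for a thin resistive wall at `b > a` with
  `δW_b ≠ 0` … see `rwm_grows_of_lt` (growth inside the critical radius).
MODELLED as in `RwmFRS1Energy.lean` (W6 verbatim; declared `R₀ = 5a`; thin wall; no rotation); a statement about M_RWM's
`(3,1)` mode, nothing about a device. [cite: Freidberg2014, §11.5.6 eqs. (11.149)–(11.151), Fig. 11.26] [instance data]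
-/

noncomputable section

open Set Filter Literature.MathematicalPhysics.MHD Literature.MathematicalPhysics.MHD.ScrewPinch
open scoped Topology

namespace Summit.Ventures.FusionMHD.Models

namespace RwmFRS1

/-- The hypotheses of lit-3's critical-wall theorems for the `(3,1)` marginal solution: `F_a ≠ 0`, `ξ₁(a) ≠ 0`,
`δW_∞ < 0` (with the mode number as the natural number `3`). [instance data] -/
theorem criticalWall_hyps : P.kDotB ((3 : ℕ) : ℝ) kk 1 ≠ 0 ∧ xi 1 ≠ 0 ∧
    P.externalEnergy ((3 : ℕ) : ℝ) kk 1 (Vacuum.wallFactorInf 3 kk 1) xi < 0 := by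
  have h1 : P.kDotB 3 kk 1 ≠ 0 := by rw [edge_values.1]; norm_num
  have h3 := dWinf_neg
  rw [dWinf] at h3
  refine ⟨?_, xi_ne_zero 1 ⟨one_pos, le_rfl⟩, ?_⟩
  · simpa only [Nat.cast_ofNat] using h1
  · simpa only [Nat.cast_ofNat] using h3

/-- **THE CRITICAL WALL RADIUS EXISTS OUTSIDE THE PLASMA**: `1 < b*` and the ideal-wall energy vanishes there,
`δW_{b*} = 0`. [cite: Freidberg2014, §11.5.6 eqs. (11.149)–(11.151) and Fig. 11.26] -/
theorem criticalWallRadius_spec' : 1 < P.criticalWallRadius 3 kk 1 xi ∧ dWb (P.criticalWallRadius 3 kk 1 xi) = 0 := by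
  obtain ⟨hF, hξ, hinf⟩ := criticalWall_hyps
  have hk : kk ≠ 0 := by rw [kk]; norm_num
  obtain ⟨h1, -⟩ := P.criticalWallRadius_spec (m := 3) (by norm_num) hk one_pos hF hξ hinf
  refine ⟨h1, ?_⟩
  have h0 := (P.externalEnergy_wall_eq_zero_iff (m := 3) (by norm_num) hk one_pos hF hξ hinf h1).2 rfl
  rw [dWb]
  simpa only [Nat.cast_ofNat] using h0

/-- **`δW_b > 0 ⇔ b < b*`** for every wall `b > a = 1`. [cite: Freidberg2014, §11.5.6 eqs. (11.149)–(11.151), p. 491] -/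
theorem dWb_pos_iff {b : ℝ} (hb : 1 < b) : 0 < dWb b ↔ b < P.criticalWallRadius 3 kk 1 xi := by
  obtain ⟨hF, hξ, hinf⟩ := criticalWall_hyps
  have hk : kk ≠ 0 := by rw [kk]; norm_num
  have h := P.externalEnergy_wall_pos_iff (m := 3) (by norm_num) hk one_pos hF hξ hinf hb
  rw [dWb]
  simpa only [Nat.cast_ofNat] using h

/-- **`δW_b < 0 ⇔ b* < b`** for every wall `b > a = 1`. [cite: Freidberg2014, §11.5.6 eqs. (11.149)–(11.151), p. 491] -/
theorem dWb_neg_iff {b : ℝ} (hb : 1 < b) : dWb b < 0 ↔ P.criticalWallRadius 3 kk 1 xi < b := by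
  obtain ⟨hF, hξ, hinf⟩ := criticalWall_hyps
  have hk : kk ≠ 0 := by rw [kk]; norm_num
  have h := P.externalEnergy_wall_neg_iff (m := 3) (by norm_num) hk one_pos hF hξ hinf hb
  rw [dWb]
  simpa only [Nat.cast_ofNat] using h

/-- UNIQUENESS: `δW_b = 0 ⇔ b = b*` for every wall `b > a = 1`. [cite: Freidberg2014, §11.5.6 Fig. 11.26] -/
theorem dWb_eq_zero_iff {b : ℝ} (hb : 1 < b) : dWb b = 0 ↔ b = P.criticalWallRadius 3 kk 1 xi := by
  obtain ⟨hF, hξ, hinf⟩ := criticalWall_hyps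
  have hk : kk ≠ 0 := by rw [kk]; norm_num
  have h := P.externalEnergy_wall_eq_zero_iff (m := 3) (by norm_num) hk one_pos hF hξ hinf hb
  rw [dWb]
  simpa only [Nat.cast_ofNat] using h

/-- **`1.05a < b_crit < 1.10a`**: the critical wall radius of the `(3,1)` mode of MODEL M_RWM lies strictly between the two
DECLARED wall radii (`δW_b(21/20) > 0`, `δW_b(11/10) < 0`; VALIDATED float `1.0714a`). [instance data] -/
theorem criticalWallRadius_bounds : (21 / 20 : ℝ) < P.criticalWallRadius 3 kk 1 xi ∧
    P.criticalWallRadius 3 kk 1 xi < (11 / 10 : ℝ) :=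
  ⟨(dWb_pos_iff (by norm_num)).1 dWb_pos, (dWb_neg_iff (by norm_num)).1 dWb_neg⟩

/-- **IDEAL-WALL STABILITY ⇔ WALL INSIDE THE CRITICAL RADIUS**: for every wall `b > a = 1`, ALL admissible
displacements have positive ideal-wall energy in MODEL M_RWM, mode `(3,1)`, iff `b < b*` (lit-4's external-mode test
with the kernel `ξ₁`). [cite: Freidberg2014, §11.5.3 eq. (11.118); §11.5.6 p. 491] -/
theorem idealWall_stable_iff {b : ℝ} (hb : 1 < b) :
    (∀ ξ : ℝ → ℝ, IsAdmissible ξ → 0 < P.externalEnergy 3 kk 1 (Vacuum.wallFactor 3 kk 1 b) ξ) ↔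
      b < P.criticalWallRadius 3 kk 1 xi := by
  rw [externalModes_iff, ← externalEnergy_xi, ← dWb_pos_iff hb, dWb]

/-- **THE RWM GROWS FOR EVERY THIN WALL INSIDE THE CRITICAL RADIUS** (`1 < b < b*`): every `γ` of the printed relation
`γτ_w·δW_b = −δW_∞` with `τ_w > 0` is positive. [cite: Freidberg2014, §11.5.6 eq. (11.169) and p. 492] -/
theorem rwm_grows_of_lt {b γ τw : ℝ} (hb : 1 < b) (hlt : b < P.criticalWallRadius 3 kk 1 xi) (hτ : 0 < τw)
    (h : ResistiveWall.IsThinWallRate dWinf (dWb b) τw γ) : 0 < γ :=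
  h.growth_pos hτ dWinf_neg ((dWb_pos_iff hb).2 hlt)

end RwmFRS1

end Summit.Ventures.FusionMHD.Models

end
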